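import Literature.NumberTheory.LFunctions.VinogradovKorobovFarZerosWindow
import Literature.NumberTheory.LFunctions.VinogradovKorobovFarZerosTail
import Literature.NumberTheory.LFunctions.ZetaRealAxis
import HarnessLib

/-!
# Lemma 4.6 of Mossinghoff–Trudgian–Yang (the far-zero sum) from (3.8) and Lemma 4.5

Topic `Literature/NumberTheory/LFunctions`. Everything here is PROVED; no named fact is
introduced. **Lemma 4.6** of Mossinghoff–Trudgian–Yang (*Res. Number Theory* 10 (2024) =
arXiv:2212.06867): for `t ≥ 10⁴`, `0 < η ≤ 1/4` (and the constants `A`, `B` of (3.1)),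

  `Σ_{|1+it−ρ| ≥ η} |1+it−ρ|^{-2} ≤ [5.409 + 5.392B(η^{-1/2} − 2)] log t + 206.7`
  `  + η^{-2}{(log A − log η + (2/3) log log t)/1.879 + 0.213 − N(t, η)}`

— the tree's `mtyFarZeroBound A B t η` — "in the same manner as [Ford 2002, Lemma 4.3], except we
use (3.8) in place of a classical inequality of Rosser, and propagate the new constant of
Lemma 4.5". This is hypothesis `h46` of the in-tree assembly of MTY Lemma 4.7
(`zero_inequality_mossinghoff_trudgian_yang_of_detector_bound`, `VinogradovKorobovZeroDetector.lean`).

`mty_lemma_4_6_of_hsw` (and `mty_lemma_4_6_with`, the same with the Lemma-4.5 constant `0.479` as a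
parameter `c₄₅`, conclusion `mtyFarZeroBoundWith (c₄₅ − 500/1879)`): the bound for every finite set
of zeros with `|1 + it − ρ| > η` (the
strict far sum that Ford's partition near/far produces, `FordFarZeroSumLT`), from
* `h38 : zetaZeroCount_hasanalizade_shen_wong` — (3.8), the tree's named fact, as a hypothesis;
* `h45` — MTY **Lemma 4.5** (`N(t, η) ≤ 1.3478 η^{3/2} B log t + 0.479 + (log A − log η +
  (2/3) log log t)/1.879` for `t ≥ 100`, `0 < η ≤ 1/4`), as a hypothesis in predicate form (it
  rests on Ford's zero detector, Lemma 4.1, not yet in the tree).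

Proof = Ford's, assembled from the tree: the window `|γ − t| < 1`
(`FarZeros.sum_window_part_le`: pairing `ρ ↦ 1 − ρ̄`, reflected disc, annulus by layer cake),
`I₁` (`FarZeros.sum_upper_ordinates_le`), `I₂`, `I₃` (`FordFarZeros.lower_tail_sum_le`,
`neg_ordinates_sum_le`), the window count and (3.8) (`FordFarZeros.window_count_le`,
`hsw_bounds`), the annulus integral `2∫_η^{1/4} N(t,u)u⁻³ du` evaluated with Lemma 4.5
(`annulus_integral_le`), and the numerics: the coefficient of `log t` comes to
`2/(2π) + (80/9)/π + (4 + 160/9)·0.1038 = 5.4084 ≤ 5.409`, that of `log log t` to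
`(4 + 160/9)·0.2573 − 16·(2/3)/1.879 < 0`, the constant to `< 190 ≤ 206.7`, and
`0.479 − 1/(2·1.879) = 0.2129 ≤ 0.213`, `4·1.3478 = 5.3912 ≤ 5.392`.

## References

* M. J. Mossinghoff, T. S. Trudgian, A. Yang, arXiv:2212.06867, Lemmas 4.5, 4.6 and (3.8).
  (`MossinghoffTrudgianYangRNT2024`)
* K. Ford, *Zero-free regions for the Riemann zeta function* (2002) = arXiv:1910.08205, proof of
  Lemma 4.3. (`Ford2002Millennium`)
-/

noncomputable section

open Complex Real MeasureTheory Finset Set Filter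
open scoped Topology

namespace Literature.NumberTheory.LFunctions

namespace FarZeros

open FordFarZeros (rvmMain hswErr hsw_bounds hswErr_mono hswErr_nonneg)

/-! ## The annulus integral `∫_η^{1/4} 2u⁻³ N(t,u) du` under Lemma 4.5 -/

/-- An antiderivative for `2u⁻³(α u√u + β − (log u)/c)`:
`F(u) = −4α/√u − β/u² + (1/c)(log u/u² + 1/(2u²))`. [folklore] -/
theorem hasDerivAt_annulusPrim {α β c : ℝ} (hc : c ≠ 0) {u : ℝ} (hu : 0 < u) :
    HasDerivAt (fun u : ℝ ↦ -4 * α / Real.sqrt u - β / u ^ 2 + 1 / c * (Real.log u / u ^ 2 + 1 / (2 * u ^ 2)))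
      (2 / u ^ 3 * (α * (u * Real.sqrt u) + β - Real.log u / c)) u := by
  have hs : 0 < Real.sqrt u := Real.sqrt_pos.2 hu
  have hsq : Real.sqrt u * Real.sqrt u = u := Real.mul_self_sqrt hu.le
  have d1 := (hasDerivAt_const u (-4 * α)).fun_div (Real.hasDerivAt_sqrt hu.ne') hs.ne'
  have hp2 : HasDerivAt (fun u : ℝ ↦ u ^ 2) (2 * u) u := by simpa using hasDerivAt_pow 2 u
  have d2 := (hasDerivAt_const u β).fun_div hp2 (pow_ne_zero 2 hu.ne')
  have d3 := (Real.hasDerivAt_log hu.ne').fun_div hp2 (pow_ne_zero 2 hu.ne')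
  have hp2' : HasDerivAt (fun u : ℝ ↦ 2 * u ^ 2) (2 * (2 * u)) u := hp2.const_mul 2
  have d4 := (hasDerivAt_const u (1 : ℝ)).fun_div hp2' (by positivity)
  have d := (d1.fun_sub d2).fun_add ((d3.fun_add d4).const_mul (1 / c))
  refine d.congr_deriv ?_
  obtain ⟨s, hs0, hs2⟩ : ∃ s : ℝ, 0 < s ∧ Real.sqrt u = s := ⟨_, hs, rfl⟩
  have hu' : u = s * s := by rw [← hs2]; exact hsq.symm
  rw [hs2]
  subst hu'
  have hss : s * s ≠ 0 := by positivity
  field_simp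
  ring

/-- **The annulus integral under Lemma 4.5**: if `N(t, u) ≤ α u√u + β − (log u)/c` on `[η, 1/4]`
then `∫_η^{1/4} 2u⁻³ N(t,u) du ≤ 4α(η^{-1/2} − 2) + β(η⁻² − 16) + (1/c)(16 log(1/4) + 8 − log η/η² − 1/(2η²))`
(Ford: "By Lemma 4.2, `2∫_v^{1/4} N(t,u)u⁻³ du ≤ …`"). [cite: Ford2002Millennium, proof of Lemma 4.3] -/
theorem annulus_integral_le {t η α β c : ℝ} (hη : 0 < η) (hη4 : η ≤ 1 / 4) (hc : 0 < c)
    (hN : ∀ u : ℝ, η ≤ u → u ≤ 1 / 4 → fordN t u ≤ α * (u * Real.sqrt u) + β - Real.log u / c) :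
    ∫ u in η..(1 / 4), 2 / u ^ 3 * fordN t u
      ≤ 4 * α * (1 / Real.sqrt η - 2) + β * (1 / η ^ 2 - 16)
        + 1 / c * (16 * Real.log (1 / 4) + 8 - Real.log η / η ^ 2 - 1 / (2 * η ^ 2)) := by
  have hcont : ContinuousOn (fun u : ℝ ↦ 2 / u ^ 3) (uIcc η (1 / 4)) := by
    refine continuousOn_const.div (continuousOn_pow 3) fun x hx ↦ ?_
    rw [Set.uIcc_of_le hη4, Set.mem_Icc] at hx
    exact pow_ne_zero 3 (by linarith)
  have hpos : ∀ x ∈ uIcc η (1 / 4), 0 < x := fun x hx ↦ by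
    rw [Set.uIcc_of_le hη4, Set.mem_Icc] at hx; linarith
  have hcontB : ContinuousOn (fun u : ℝ ↦ 2 / u ^ 3 * (α * (u * Real.sqrt u) + β - Real.log u / c)) (uIcc η (1 / 4)) := by
    refine hcont.mul ((((continuousOn_const.mul (continuousOn_id.mul (Real.continuous_sqrt.continuousOn))).add
      continuousOn_const).sub ((Real.continuousOn_log.mono fun x hx ↦ ?_).div_const c)))
    simp only [Set.mem_compl_iff, Set.mem_singleton_iff]
    exact (hpos x hx).ne'
  have hint1 : IntervalIntegrable (fun u ↦ 2 / u ^ 3 * fordN t u) volume η (1 / 4) :=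
    ((fordN_mono t).intervalIntegrable).continuousOn_mul hcont
  have hmono : ∫ u in η..(1 / 4), 2 / u ^ 3 * fordN t u
      ≤ ∫ u in η..(1 / 4), 2 / u ^ 3 * (α * (u * Real.sqrt u) + β - Real.log u / c) := by
    refine intervalIntegral.integral_mono_on hη4 hint1 hcontB.intervalIntegrable fun u hu ↦ ?_
    rw [Set.mem_Icc] at hu
    exact mul_le_mul_of_nonneg_left (hN u hu.1 hu.2) (div_nonneg (by norm_num) (pow_nonneg (by linarith) 3))
  refine hmono.trans (le_of_eq ?_)
  rw [intervalIntegral.integral_eq_sub_of_hasDerivAt (fun u hu ↦ hasDerivAt_annulusPrim hc.ne' (hpos u hu))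
    hcontB.intervalIntegrable]
  have hs4 : Real.sqrt (1 / 4) = 1 / 2 := by
    rw [show (1 / 4 : ℝ) = (1 / 2) ^ 2 by norm_num, Real.sqrt_sq (by norm_num)]
  rw [hs4]
  have hη0 : η ≠ 0 := hη.ne'
  have hsη : Real.sqrt η ≠ 0 := (Real.sqrt_pos.2 hη).ne'
  field_simp
  ring

/-! ## `q = hswErr` satisfies the hypotheses of `I₁` on `[14, ∞)` -/

/-- `2 < log 14`. [folklore] -/
theorem two_lt_log_fourteen : 2 < Real.log 14 := by
  rw [Real.lt_log_iff_exp_lt (by norm_num)]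
  have h : Real.exp 2 = Real.exp 1 * Real.exp 1 := by rw [← Real.exp_add]; norm_num
  rw [h]
  nlinarith [Real.exp_one_lt_d9, Real.exp_pos 1]

/-- `q(T) ≤ 6 log T` for `T ≥ 14`. [folklore] -/
theorem hswErr_le_six_log {T : ℝ} (hT : 14 ≤ T) : hswErr T ≤ 6 * Real.log T := by
  unfold FordFarZeros.hswErr
  have hl : 2 < Real.log T := two_lt_log_fourteen.trans_le (Real.log_le_log (by norm_num) hT)
  have hll : Real.log (Real.log T) ≤ Real.log T := (Real.log_le_sub_one_of_pos (by linarith)).trans (by linarith)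
  nlinarith

/-- `1/π ≤ 0.31831` and `1/(2π) ≤ 0.159155`. [folklore] -/
theorem inv_pi_le : 1 / π ≤ 0.31831 ∧ 1 / (2 * π) ≤ 0.159155 := by
  have h := Real.pi_gt_d6
  constructor
  · rw [div_le_iff₀ Real.pi_pos]; nlinarith
  · rw [div_le_iff₀ (by positivity)]; nlinarith

/-- `log 10⁴ ≥ 9` (`e⁹ < 8104`). [folklore] -/
theorem log_ten_thousand_ge : (9 : ℝ) ≤ Real.log 10000 := by
  rw [Real.le_log_iff_exp_le (by norm_num)]
  have h : Real.exp 9 = Real.exp 1 ^ 9 := by rw [← Real.exp_nat_mul]; norm_num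
  rw [h]
  have h1 := Real.exp_one_lt_d9
  have h0 := Real.exp_pos 1
  have : Real.exp 1 ^ 9 ≤ 2.7182818286 ^ 9 := pow_le_pow_left₀ h0.le h1.le 9
  nlinarith

/-! ## Lemma 4.6 -/

/-- Small elementary bounds at height `t ≥ 10⁴` used in the numerics. [folklore] -/
theorem height_facts {t : ℝ} (ht : 10000 ≤ t) :
    9 ≤ Real.log t ∧ 0 ≤ Real.log (Real.log t)
      ∧ Real.log (t + 1) ≤ Real.log t + 0.0001
      ∧ Real.log (Real.log (t + 1)) ≤ Real.log (Real.log t) + 0.0001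
      ∧ Real.log (2 * t) ≤ Real.log t + 0.6932
      ∧ Real.log (Real.log (2 * t)) ≤ Real.log (Real.log t) + 0.0771
      ∧ Real.log t ≤ t / 50 := by
  have ht0 : 0 < t := by linarith
  have hL : 9 ≤ Real.log t := log_ten_thousand_ge.trans (Real.log_le_log (by norm_num) ht)
  have hL0 : 0 < Real.log t := by linarith
  have hLL : 0 ≤ Real.log (Real.log t) := Real.log_nonneg (by linarith)
  -- `log(t+1) ≤ log t + 1/t`
  have h1 : Real.log (t + 1) ≤ Real.log t + 0.0001 := by
    have h := Real.log_le_sub_one_of_pos (show 0 < (t + 1) / t by positivity)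
    rw [Real.log_div (by linarith) ht0.ne'] at h
    have : (t + 1) / t - 1 = 1 / t := by field_simp; ring
    rw [this] at h
    have h2 : 1 / t ≤ 0.0001 := by rw [div_le_iff₀ ht0]; linarith
    linarith
  have h1' : Real.log (Real.log (t + 1)) ≤ Real.log (Real.log t) + 0.0001 := by
    have hpos : 0 < Real.log (t + 1) := by linarith [Real.log_le_log ht0 (by linarith : t ≤ t + 1)]
    have h := Real.log_le_sub_one_of_pos (show 0 < Real.log (t + 1) / Real.log t by positivity)
    rw [Real.log_div hpos.ne' hL0.ne'] at h
    have h3 : Real.log (t + 1) / Real.log t - 1 ≤ 0.0001 := by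
      rw [div_sub_one hL0.ne', div_le_iff₀ hL0]; nlinarith
    linarith
  have h2 : Real.log (2 * t) ≤ Real.log t + 0.6932 := by
    rw [Real.log_mul (by norm_num) ht0.ne']; linarith [Real.log_two_lt_d9]
  have h2' : Real.log (Real.log (2 * t)) ≤ Real.log (Real.log t) + 0.0771 := by
    have hpos : 0 < Real.log (2 * t) := by rw [Real.log_mul (by norm_num) ht0.ne']; linarith [Real.log_two_gt_d9]
    have h := Real.log_le_sub_one_of_pos (show 0 < Real.log (2 * t) / Real.log t by positivity)
    rw [Real.log_div hpos.ne' hL0.ne'] at h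
    have h3 : Real.log (2 * t) / Real.log t - 1 ≤ 0.0771 := by
      rw [div_sub_one hL0.ne', div_le_iff₀ hL0]; nlinarith
    linarith
  have h3 : Real.log t ≤ t / 50 := by
    have h := FordFarZeros.log_le_two_sqrt ht0
    have hs : 100 ≤ Real.sqrt t := by
      rw [show (100 : ℝ) = Real.sqrt (100 ^ 2) by rw [Real.sqrt_sq (by norm_num)]]
      exact Real.sqrt_le_sqrt (by linarith)
    have hss : Real.sqrt t * Real.sqrt t = t := Real.mul_self_sqrt ht0.le
    have h4 : 100 * Real.sqrt t ≤ t := by nlinarith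
    linarith
  exact ⟨hL, hLL, h1, h1', h2, h2', h3⟩

set_option maxHeartbeats 1600000 in
/-- **Lemma 4.6 of Mossinghoff–Trudgian–Yang from (3.8) and Lemma 4.5, with the Lemma-4.5
constant as a parameter**: if `N(t,u) ≤ 1.3478 u^{3/2} B log t + c₄₅ + (log A − log u +
(2/3) log log t)/1.879` for `t ≥ 100`, `0 < u ≤ 1/4` (MTY Lemma 4.5 is `c₄₅ = 0.479`, Ford's
Lemma 4.2 has `0.49`) with `c₄₅ ≥ 0`, then for `t ≥ 10⁴`, `0 < η ≤ 1/4`, `A > 1`, `B > 0` and every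
finite set of strip zeros with `|1 + it − ρ| > η`,
`Σ m/|1+it−ρ|² ≤ mtyFarZeroBoundWith (c₄₅ − 500/1879) A B t η` (MTY: "we propagate the new
constant (4.10) in the bound for `N(t, η)` through to this bound, where we obtain
`0.479 − 1/(2(1.879)) ≤ 0.213`"). [cite: MossinghoffTrudgianYangRNT2024, Lemma 4.6]
[cite: Ford2002Millennium, Lemma 4.3] -/
theorem mty_lemma_4_6_with (h38 : zetaZeroCount_hasanalizade_shen_wong)
    {A B c45 : ℝ} (hA : 1 < A) (hB : 0 < B) (hc45 : 0 ≤ c45)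
    (h45 : ∀ t u : ℝ, 100 ≤ t → 0 < u → u ≤ 1 / 4 →
      fordN t u ≤ 1.3478 * u ^ (3 / 2 : ℝ) * B * Real.log t + c45
        + (Real.log A - Real.log u + 2 / 3 * Real.log (Real.log t)) / 1.879)
    {t η : ℝ} (ht : 10000 ≤ t) (hη : 0 < η) (hη4 : η ≤ 1 / 4) (T : Finset ℂ)
    (hT : ∀ ρ ∈ T, riemannZeta ρ = 0 ∧ 0 < ρ.re ∧ ρ.re < 1 ∧ η < ‖1 + (t : ℂ) * I - ρ‖) :
    ∑ ρ ∈ T, (riemannZetaZeroOrder ρ : ℝ) / ‖1 + (t : ℂ) * I - ρ‖ ^ 2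
      ≤ mtyFarZeroBoundWith (c45 - 500 / 1879) A B t η := by
  classical
  obtain ⟨hL, hLL, hl1, hll1, hl2, hll2, hLt⟩ := height_facts ht
  obtain ⟨hinvπ, hinv2π⟩ := inv_pi_le
  have hπ := Real.pi_pos
  have hπ3 := Real.pi_gt_three
  have ht0 : 0 < t := by linarith
  have ht10 : (10 : ℝ) ≤ t := by linarith
  have he3 : Real.exp 1 < 3 := lt_trans Real.exp_one_lt_d9 (by norm_num)
  set L : ℝ := Real.log t with hLdef
  set LL : ℝ := Real.log (Real.log t) with hLLdef
  set Fρ : ℂ → ℝ := fun ρ ↦ (riemannZetaZeroOrder ρ : ℝ) / ‖1 + (t : ℂ) * I - ρ‖ ^ 2 with hF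
  -- no zero has `Im ρ = 0`
  have him0 : ∀ ρ ∈ T, ρ.im ≠ 0 := by
    intro ρ hρ h0
    obtain ⟨hz, h0', h1', -⟩ := hT ρ hρ
    exact riemannZeta_ne_zero_of_im_eq_zero_of_pos_of_lt_one h0 h0' h1' hz
  -- the partition
  set TW := T.filter fun ρ ↦ |ρ.im - t| < 1 with hTW
  set R1 := T.filter fun ρ ↦ ¬ (|ρ.im - t| < 1) with hR1
  set T1 := R1.filter fun ρ ↦ t + 1 ≤ ρ.im with hT1
  set R2 := R1.filter fun ρ ↦ ¬ (t + 1 ≤ ρ.im) with hR2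
  set T2 := R2.filter fun ρ ↦ 0 < ρ.im with hT2
  set T3 := R2.filter fun ρ ↦ ¬ (0 < ρ.im) with hT3
  have hsplit : ∑ ρ ∈ T, Fρ ρ = ∑ ρ ∈ TW, Fρ ρ + ∑ ρ ∈ T1, Fρ ρ + ∑ ρ ∈ T2, Fρ ρ + ∑ ρ ∈ T3, Fρ ρ := by
    rw [← Finset.sum_filter_add_sum_filter_not T (fun ρ ↦ |ρ.im - t| < 1) Fρ, ← hTW, ← hR1,
      ← Finset.sum_filter_add_sum_filter_not R1 (fun ρ ↦ t + 1 ≤ ρ.im) Fρ, ← hT1, ← hR2,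
      ← Finset.sum_filter_add_sum_filter_not R2 (fun ρ ↦ 0 < ρ.im) Fρ, ← hT2, ← hT3]
    ring
  have hbase : ∀ S : Finset ℂ, S ⊆ T → ∀ ρ ∈ S, riemannZeta ρ = 0 ∧ 0 < ρ.re ∧ ρ.re < 1 :=
    fun S hS ρ hρ ↦ ⟨(hT ρ (hS hρ)).1, (hT ρ (hS hρ)).2.1, (hT ρ (hS hρ)).2.2.1⟩
  have hR1sub : R1 ⊆ T := Finset.filter_subset _ _
  have hT1sub : T1 ⊆ T := (Finset.filter_subset _ _).trans hR1sub
  have hR2sub : R2 ⊆ T := (Finset.filter_subset _ _).trans hR1sub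
  have hT2sub : T2 ⊆ T := (Finset.filter_subset _ _).trans hR2sub
  have hT3sub : T3 ⊆ T := (Finset.filter_subset _ _).trans hR2sub
  have hW1 : ∀ ρ ∈ T1, riemannZeta ρ = 0 ∧ t + 1 ≤ ρ.im := fun ρ hρ ↦
    ⟨(hT ρ (hT1sub hρ)).1, (Finset.mem_filter.1 hρ).2⟩
  have hW2 : ∀ ρ ∈ T2, 0 < ρ.im ∧ ρ.im ≤ t - 1 := fun ρ hρ ↦ by
    have h2 := Finset.mem_filter.1 hρ
    have hr2 := Finset.mem_filter.1 h2.1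
    have hr1 := Finset.mem_filter.1 hr2.1
    refine ⟨h2.2, ?_⟩
    have hge : 1 ≤ |ρ.im - t| := not_lt.1 hr1.2
    have hlt : ρ.im < t + 1 := not_le.1 hr2.2
    rcases le_abs'.1 hge with h | h <;> linarith
  have hW3 : ∀ ρ ∈ T3, ρ.im < 0 := fun ρ hρ ↦ by
    have h3 := Finset.mem_filter.1 hρ
    exact lt_of_le_of_ne (not_lt.1 h3.2) (him0 ρ (hT3sub hρ))
  -- (3.8) as hypotheses for `I₁`, `I₂`
  have hq₁ : ∀ u : ℝ, 14 ≤ u → (zetaZeroCount u : ℝ) ≤ rvmMain u + hswErr u := fun u hu ↦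
    (hsw_bounds h38 (by linarith)).2
  have hq₂ : ∀ u : ℝ, 14 ≤ u → rvmMain u - hswErr u ≤ (zetaZeroCount u : ℝ) := fun u hu ↦
    (hsw_bounds h38 (by linarith)).1
  have hqm : MonotoneOn hswErr (Set.Ici 14) := fun a ha b _ hab ↦
    hswErr_mono (le_trans he3.le (by linarith [Set.mem_Ici.1 ha])) hab
  have hq0 : 0 ≤ hswErr 14 := hswErr_nonneg (by linarith)
  -- the four pieces
  have hS1 : ∑ ρ ∈ T1, Fρ ρ ≤ 1 / (2 * π) * (Real.log ((t + 1) / (2 * π)) + Real.log (t + 1) / t)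
      + hswErr (t + 1) + hswErr (2 * t) + 6 * (3 * Real.log (2 * t) + 1) / t ^ 2 :=
    sum_upper_ordinates_le (by linarith) hq₁ hq₂ hqm hq0 (fun u hu ↦ hswErr_le_six_log hu) T1 hW1
  have hS2 : ∑ ρ ∈ T2, Fρ ρ ≤ 2 * hswErr (t - 1) + 1 / (2 * π) * Real.log (t / (2 * π)) := by
    refine FordFarZeros.lower_tail_sum_le ht10 (hswErr_nonneg (by linarith)) T2 (hbase T2 hT2sub) hW2
      (fun u hu ↦ ?_) (hsw_bounds h38 (show Real.exp 1 ≤ t - 1 by linarith)).2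
    have hb := (hsw_bounds h38 hu.1).1
    have hm := hswErr_mono hu.1 hu.2
    linarith
  have hS3 : ∑ ρ ∈ T3, Fρ ρ ≤ (3 * Real.log t + 2) / t + 20 / t ^ 2 :=
    FordFarZeros.neg_ordinates_sum_le ht10 T3 (hbase T3 hT3sub) hW3 fun u hu ↦ FordFarZeros.count_le_crude h38 hu
  have hS4 : ∑ ρ ∈ TW, Fρ ρ ≤ 80 / 9 * ((zetaZeroCount (t + 1) : ℝ) - zetaZeroCount (t - 1)) - fordN t η / η ^ 2
      + ∫ u in η..(1 / 4), 2 / u ^ 3 * fordN t u :=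
    sum_window_part_le (by linarith) hη hη4 T hT
  have hWin := FordFarZeros.window_count_le h38 ht10
  -- the annulus integral, with Lemma 4.5 at height `t`
  set α : ℝ := 1.3478 * B * L with hα
  set β : ℝ := c45 + (Real.log A + 2 / 3 * LL) / 1.879 with hβ
  have hann : ∫ u in η..(1 / 4), 2 / u ^ 3 * fordN t u
      ≤ 4 * α * (1 / Real.sqrt η - 2) + β * (1 / η ^ 2 - 16)
        + 1 / 1.879 * (16 * Real.log (1 / 4) + 8 - Real.log η / η ^ 2 - 1 / (2 * η ^ 2)) := by
    refine annulus_integral_le hη hη4 (by norm_num) fun u hu1 hu2 ↦ ?_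
    have hu0 : 0 < u := by linarith
    have h := h45 t u (by linarith) hu0 hu2
    have e : u ^ (3 / 2 : ℝ) = u * Real.sqrt u := by
      rw [show (3 / 2 : ℝ) = 1 + 1 / 2 by norm_num, Real.rpow_add hu0, Real.rpow_one, Real.sqrt_eq_rpow]
    rw [e] at h
    have e2 : 1.3478 * (u * Real.sqrt u) * B * Real.log t + c45
        + (Real.log A - Real.log u + 2 / 3 * Real.log (Real.log t)) / 1.879
        = α * (u * Real.sqrt u) + β - Real.log u / 1.879 := by
      simp only [hα, hβ, hLdef, hLLdef]; ring
    linarith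
  -- numerics
  have hq_t : hswErr t = 0.1038 * L + 0.2573 * LL + 9.3675 := rfl
  have hq_tm1 : hswErr (t - 1) ≤ hswErr t := hswErr_mono (by linarith) (by linarith)
  have hq_tp1 : hswErr (t + 1) ≤ 0.1038 * (L + 0.0001) + 0.2573 * (LL + 0.0001) + 9.3675 := by
    unfold FordFarZeros.hswErr; linarith
  have hq_2t : hswErr (2 * t) ≤ 0.1038 * (L + 0.6932) + 0.2573 * (LL + 0.0771) + 9.3675 := by
    unfold FordFarZeros.hswErr; linarith
  have hlogt2π : Real.log (t / (2 * π)) ≤ L := FordFarZeros.log_div_two_pi_le ht0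
  have hlogt12π : Real.log ((t + 1) / (2 * π)) ≤ L + 0.0001 := (FordFarZeros.log_div_two_pi_le (by linarith)).trans hl1
  have hlogt12π0 : 0 ≤ Real.log ((t + 1) / (2 * π)) :=
    Real.log_nonneg (by rw [le_div_iff₀ (by positivity)]; nlinarith [Real.pi_lt_d2])
  have hlogt2π0 : 0 ≤ Real.log (t / (2 * π)) :=
    Real.log_nonneg (by rw [le_div_iff₀ (by positivity)]; nlinarith [Real.pi_lt_d2])
  -- `I₁` main term
  have hS1a : 1 / (2 * π) * (Real.log ((t + 1) / (2 * π)) + Real.log (t + 1) / t)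
      ≤ 0.159155 * (L + 0.0001 + (L + 0.0001) * 0.0001) := by
    have h1 : Real.log (t + 1) / t ≤ (L + 0.0001) * 0.0001 := by
      rw [div_le_iff₀ ht0]
      have : 0 ≤ L + 0.0001 := by linarith
      nlinarith
    have h0 : 0 ≤ Real.log ((t + 1) / (2 * π)) + Real.log (t + 1) / t := by
      have : 0 ≤ Real.log (t + 1) / t := div_nonneg (Real.log_nonneg (by linarith)) ht0.le
      linarith
    calc _ ≤ 0.159155 * (Real.log ((t + 1) / (2 * π)) + Real.log (t + 1) / t) :=
          mul_le_mul_of_nonneg_right hinv2π h0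
      _ ≤ _ := mul_le_mul_of_nonneg_left (by linarith) (by norm_num)
  have hS1b : 6 * (3 * Real.log (2 * t) + 1) / t ^ 2 ≤ 0.0001 := by
    rw [div_le_iff₀ (by positivity)]
    have h1 : 6 * (3 * Real.log (2 * t) + 1) ≤ t := by linarith
    have h2 : t ≤ 0.0001 * t ^ 2 := by nlinarith
    linarith
  -- `I₂` main term
  have hS2a : 1 / (2 * π) * Real.log (t / (2 * π)) ≤ 0.159155 * L :=
    calc _ ≤ 0.159155 * Real.log (t / (2 * π)) := mul_le_mul_of_nonneg_right hinv2π hlogt2π0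
      _ ≤ _ := mul_le_mul_of_nonneg_left hlogt2π (by norm_num)
  -- `I₃`
  have hS3a : (3 * Real.log t + 2) / t + 20 / t ^ 2 ≤ 0.07 := by
    have h1 : (3 * Real.log t + 2) / t ≤ 0.0602 := by
      rw [div_le_iff₀ ht0]; linarith
    have h2 : 20 / t ^ 2 ≤ 0.0008 := by
      rw [div_le_iff₀ (by positivity)]; nlinarith
    linarith
  -- window count main term
  have hS4a : 1 / π * Real.log ((t + 1) / (2 * π)) ≤ 0.31831 * (L + 0.0001) :=
    calc _ ≤ 0.31831 * Real.log ((t + 1) / (2 * π)) := mul_le_mul_of_nonneg_right hinvπ hlogt12π0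
      _ ≤ _ := mul_le_mul_of_nonneg_left hlogt12π (by norm_num)
  -- the annulus terms versus the target
  have hsη : 2 ≤ 1 / Real.sqrt η := by
    rw [le_div_iff₀ (Real.sqrt_pos.2 hη)]
    have : Real.sqrt η ≤ Real.sqrt (1 / 4) := Real.sqrt_le_sqrt hη4
    rw [show (1 / 4 : ℝ) = (1 / 2) ^ 2 by norm_num, Real.sqrt_sq (by norm_num)] at this
    linarith
  have hE0 : 0 < 1 / η ^ 2 := by positivity
  have hlog4 : 16 * Real.log (1 / 4) + 8 ≤ -14.179 := by
    rw [one_div, Real.log_inv, show (4 : ℝ) = 2 * 2 by norm_num, Real.log_mul (by norm_num) (by norm_num)]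
    linarith [Real.log_two_gt_d9]
  have hlA : 0 ≤ Real.log A := Real.log_nonneg hA.le
  have hBLs : 0 ≤ B * L * (1 / Real.sqrt η - 2) := by
    have : 0 ≤ L := by linarith
    have : 0 ≤ B * L := mul_nonneg hB.le this
    exact mul_nonneg this (by linarith)
  have hN0 := fordN_nonneg t η
  -- unfold the target and conclude (all `/1.879` turned into `* (1000/1879)`: `linarith` does not
  -- parse division by a decimal literal)
  have hd : ∀ y : ℝ, y / 1.879 = y * (1000 / 1879) := fun y ↦ by rw [div_eq_mul_one_div]; norm_num
  have eα : 4 * α * (1 / Real.sqrt η - 2) = 5.3912 * (B * L * (1 / Real.sqrt η - 2)) := by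
    simp only [hα]; ring
  set P : ℝ := B * L * (1 / Real.sqrt η - 2) with hP
  set X : ℝ := (Real.log A - Real.log η + 2 / 3 * LL) * (1000 / 1879) with hX
  have eβ : β * (1 / η ^ 2 - 16) + 1 * (1000 / 1879) * (16 * Real.log (1 / 4) + 8 - Real.log η / η ^ 2 - 1 / (2 * η ^ 2))
      = 1 / η ^ 2 * (X + (c45 - 500 / 1879))
        - 16 * c45 - 16 * (Real.log A + 2 / 3 * LL) * (1000 / 1879)
        + (1000 / 1879) * (16 * Real.log (1 / 4) + 8) := by
    simp only [hβ, hX, hd]; field_simp; ring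
  have hc16 : 0 ≤ 16 * c45 := by positivity
  have htarget_B : 5.3912 * P ≤ 5.392 * P := by
    have : 0 ≤ P := hBLs
    nlinarith
  have hlog4' : (1000 / 1879 : ℝ) * (16 * Real.log (1 / 4) + 8) ≤ -7.546 := by
    rw [show (-7.546 : ℝ) = (1000 / 1879) * (-7.546 * 1.879) by norm_num]
    exact mul_le_mul_of_nonneg_left (by linarith) (by norm_num)
  simp only [hd] at hann
  -- staged linear assembly
  have hW' : ∑ ρ ∈ TW, Fρ ρ ≤ 80 / 9 * (0.31831 * (L + 0.0001)
      + (0.1038 * (L + 0.0001) + 0.2573 * (LL + 0.0001) + 9.3675) + (0.1038 * L + 0.2573 * LL + 9.3675))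
      - fordN t η / η ^ 2 + 5.392 * P + 1 / η ^ 2 * (X + (c45 - 500 / 1879))
      - 16 * c45 - 16 * (Real.log A + 2 / 3 * LL) * (1000 / 1879) - 7.546 := by
    linarith [hS4, hWin, hS4a, hq_tp1, hq_tm1, hq_t, hann, eα, eβ, htarget_B, hlog4']
  have h1' : ∑ ρ ∈ T1, Fρ ρ ≤ 0.159155 * (L + 0.0001 + (L + 0.0001) * 0.0001)
      + (0.1038 * (L + 0.0001) + 0.2573 * (LL + 0.0001) + 9.3675)
      + (0.1038 * (L + 0.6932) + 0.2573 * (LL + 0.0771) + 9.3675) + 0.0001 := by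
    linarith [hS1, hS1a, hS1b, hq_tp1, hq_2t]
  have h2' : ∑ ρ ∈ T2, Fρ ρ ≤ 2 * (0.1038 * L + 0.2573 * LL + 9.3675) + 0.159155 * L := by
    linarith [hS2, hS2a, hq_tm1, hq_t]
  have h3' : ∑ ρ ∈ T3, Fρ ρ ≤ 0.07 := hS3.trans hS3a
  unfold mtyFarZeroBoundWith
  rw [hsplit, ← hLLdef, ← hLdef]
  have eP : (5.409 + 5.392 * B * (1 / Real.sqrt η - 2)) * L = 5.409 * L + 5.392 * P := by
    simp only [hP]; ring
  have eX : 1 / η ^ 2 * ((Real.log A - Real.log η + 2 / 3 * LL) / 1.879 + (c45 - 500 / 1879) - fordN t η)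
      = 1 / η ^ 2 * (X + (c45 - 500 / 1879)) - fordN t η / η ^ 2 := by
    simp only [hX, hd]; ring
  rw [eP, eX]
  linarith [hW', h1', h2', h3', hlA, hL, hLL, hc16]


/-- `mtyFarZeroBoundWith` is non-decreasing in the constant. [folklore] -/
theorem mtyFarZeroBoundWith_mono {c c' : ℝ} (h : c ≤ c') (A B t η : ℝ) :
    mtyFarZeroBoundWith c A B t η ≤ mtyFarZeroBoundWith c' A B t η := by
  unfold mtyFarZeroBoundWith
  have : 0 ≤ 1 / η ^ 2 := by positivity
  nlinarith

/-- **Lemma 4.6 of Mossinghoff–Trudgian–Yang from (3.8) and Lemma 4.5** (the printed constants: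
`c₄₅ = 0.479`, `0.479 − 1/(2·1.879) ≤ 0.213`): for `t ≥ 10⁴`, `0 < η ≤ 1/4`, `A > 1`, `B > 0`, and
every finite set `T` of zeros of `ζ` in the open strip with `|1 + it − ρ| > η`,
`Σ_{ρ ∈ T} m(ρ)/|1+it−ρ|² ≤ mtyFarZeroBound A B t η` — the shape of
`FordFarZeroSumLT t η (mtyFarZeroBound A B t η)`. [cite: MossinghoffTrudgianYangRNT2024, Lemma 4.6]
[cite: Ford2002Millennium, Lemma 4.3] -/
theorem mty_lemma_4_6_of_hsw (h38 : zetaZeroCount_hasanalizade_shen_wong)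
    {A B : ℝ} (hA : 1 < A) (hB : 0 < B)
    (h45 : ∀ t u : ℝ, 100 ≤ t → 0 < u → u ≤ 1 / 4 →
      fordN t u ≤ 1.3478 * u ^ (3 / 2 : ℝ) * B * Real.log t + 0.479
        + (Real.log A - Real.log u + 2 / 3 * Real.log (Real.log t)) / 1.879)
    {t η : ℝ} (ht : 10000 ≤ t) (hη : 0 < η) (hη4 : η ≤ 1 / 4) (T : Finset ℂ)
    (hT : ∀ ρ ∈ T, riemannZeta ρ = 0 ∧ 0 < ρ.re ∧ ρ.re < 1 ∧ η < ‖1 + (t : ℂ) * I - ρ‖) :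
    ∑ ρ ∈ T, (riemannZetaZeroOrder ρ : ℝ) / ‖1 + (t : ℂ) * I - ρ‖ ^ 2 ≤ mtyFarZeroBound A B t η := by
  rw [mtyFarZeroBound_eq_with]
  exact (mty_lemma_4_6_with h38 hA hB (by norm_num) h45 ht hη hη4 T hT).trans
    (mtyFarZeroBoundWith_mono (by norm_num) A B t η)

end FarZeros

end Literature.NumberTheory.LFunctions
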